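import Mathlib.LinearAlgebra.FiniteDimensional.Lemmas
import Mathlib.LinearAlgebra.Matrix.Permanent
import Mathlib.Tactic.LinearCombination
import Literature.LinearAlgebra.Matrix.PermanentSubperm
import Literature.Computability.AlgebraicComplexity.AlperBogartVelascoBoxThreeLines
import HarnessLib

/-!
# Linear `3`-spaces of `3 × 3` matrices with vanishing `2 × 2` subpermanents are the lines

Topic `Literature/Computability/AlgebraicComplexity`; companion (equality case) of
`AlperBogartVelascoBoxThree.lean` (`finrank_le_three_of_subperm_two_vanish`: a linear subspace `W`
of `3 × 3` matrices on which all nine `2 × 2` subpermanents vanish has `dim W ≤ 3`).  Here: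

* `exists_line_of_subperm_two_vanish`: if moreover `dim W ≥ 3` and `2 ≠ 0` in the field, then `W`
  is contained in (hence equals) the space of matrices supported on ONE ROW or on ONE COLUMN.

This is the linear-subspace shadow of the description of the singular locus of the `3 × 3`
permanent hypersurface ("readily computed, c.f. [von zur Gathen]" in Alper–Bogart–Velasco 2017,
p. 3): `Sing(perm_3) = {all 2 × 2 subpermanents vanish}` is the union of the six linear `3`-spaces
of matrices supported on a line and nine `3`-dimensional quadric cones (matrices supported on a
`2 × 2` block with `ad + bc = 0`), and the cones contain no linear `3`-space.  It is the extra
input that turns ABV's proof of `dc(perm_3) = 7` into STRUCTURE of the size-`7` representations: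
the common zero set `V(I)` of the border forms of a `7 × 7` representation is a `3`-space of this
kind, so the border forms involve exactly the variables of two parallel lines of the grid.

Proof.  With the flag `Y₂ = row₂(W)`, `Y₁ = row₁(W ∩ ker row₂)`, `Y₀ = row₀(W ∩ ker row₁ ∩ ker row₂)`
of the `≤ 3` proof (`dim W = Σ dim Y_p`, and `dim Y_q ≥ 1 ⇒ dim Y_p ≤ 1` for `p ≠ q`), `dim W = 3`
leaves the profiles `(3,0,0)`, `(0,3,0)`, `(0,0,3)` — then the quadrics between the full row and an
earlier row, evaluated on elements `x_a` with full row `e_a` and on the sums `x_a + x_b`, kill the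
earlier row (`λ_a + λ_b = 0` for all `a ≠ b`, so `2λ = 0`), and `W` is a row space — and `(1,1,1)` —
then generators `u, v, w` of the three `Y_p` are pairwise orthogonal for the pairing
`u_c v_{c'} + u_{c'} v_c` (`c ≠ c'`), which (using `2 ≠ 0` twice) forces `u, v, w ∈ K·e_c` for one
column index `c`, and the quadrics inside single elements of `W` push every row into `K·e_c`:
`W` is the column space `c`.  Characteristic `2` is genuinely excluded (`perm = det`).

## References

* J. Alper, T. Bogart, M. Velasco, *A lower bound for the determinantal complexity of a
  hypersurface*, Found. Comput. Math. 17 (2017) 829–836, arXiv:1505.02205 — Cor. 1.4, p. 3.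
* J. von zur Gathen, *Permanent and determinant*, Linear Algebra Appl. 96 (1987) 87–100, §2.
-/

noncomputable section

open Module

namespace Literature.Computability.AlgebraicComplexity

namespace AlperBogartVelasco

variable {K : Type*} [Field K]
/-- **Equality case of `finrank_le_three_of_subperm_two_vanish`.**  Over a field with `2 ≠ 0`, a
linear subspace `W` of `3 × 3` matrices of dimension `≥ 3` on which all nine `2 × 2` subpermanents
vanish is supported on a single row or on a single column (and is then the full `3`-space of such
matrices).  Equivalently: the `3`-dimensional LINEAR subspaces of the singular locus of the
`3 × 3` permanent hypersurface are exactly the six spaces of matrices supported on a line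
(ABV 2017, p. 3, "`codim Sing(perm_3) = 6` … c.f. [von zur Gathen]", linear-subspace form).
[cite: AlperBogartVelasco2017, Cor. 1.4] -/
theorem exists_line_of_subperm_two_vanish (h2 : (2 : K) ≠ 0)
    (W : Submodule K (Fin 3 × Fin 3 → K))
    (hW : ∀ x ∈ W, ∀ r c : Fin 3,
      ((Matrix.of fun i j => x (i, j)).submatrix r.succAbove c.succAbove).permanent = 0)
    (h3 : 3 ≤ finrank K W) :
    (∃ r : Fin 3, ∀ x ∈ W, ∀ i j : Fin 3, i ≠ r → x (i, j) = 0) ∨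
      (∃ c : Fin 3, ∀ x ∈ W, ∀ i j : Fin 3, j ≠ c → x (i, j) = 0) := by
  have hQ' := quadrics_of_subperm_two_vanish W hW
  -- rows as linear maps and the flag `V₀ ≤ V₁ ≤ W`
  let ρ : Fin 3 → (Fin 3 × Fin 3 → K) →ₗ[K] (Fin 3 → K) :=
    fun r => LinearMap.funLeft K K fun j => (r, j)
  have hρ : ∀ r x j, ρ r x j = x (r, j) := fun _ _ _ => rfl
  let V₁ : Submodule K (Fin 3 × Fin 3 → K) := W ⊓ LinearMap.ker (ρ 2)
  let V₀ : Submodule K (Fin 3 × Fin 3 → K) := V₁ ⊓ LinearMap.ker (ρ 1)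
  let Y : Fin 3 → Submodule K (Fin 3 → K) := ![V₀.map (ρ 0), V₁.map (ρ 1), W.map (ρ 2)]
  have hY0 : Y 0 = V₀.map (ρ 0) := rfl
  have hY1 : Y 1 = V₁.map (ρ 1) := rfl
  have hY2 : Y 2 = W.map (ρ 2) := rfl
  -- dimension count along the flag
  have hbot : (V₀ ⊓ LinearMap.ker (ρ 0) : Submodule K _) = ⊥ := by
    rw [eq_bot_iff]
    intro x hx
    simp only [V₀, V₁, Submodule.mem_inf, LinearMap.mem_ker] at hx
    obtain ⟨⟨⟨-, h2⟩, h1⟩, h0⟩ := hx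
    rw [Submodule.mem_bot]
    funext ⟨i, j⟩
    have hcases : ∀ i : Fin 3, i = 0 ∨ i = 1 ∨ i = 2 := by decide
    rcases hcases i with rfl | rfl | rfl
    · exact congr_fun h0 j
    · exact congr_fun h1 j
    · exact congr_fun h2 j
  have hdimV₀ : finrank K V₀ = finrank K (Y 0) := by
    rw [hY0, finrank_eq_finrank_map_add_finrank_inf_ker V₀ (ρ 0), hbot, finrank_bot, add_zero]
  have hdimV₁ : finrank K V₁ = finrank K (Y 1) + finrank K (Y 0) := by
    rw [hY1, finrank_eq_finrank_map_add_finrank_inf_ker V₁ (ρ 1), ← hdimV₀]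
  have hdim : finrank K W = finrank K (Y 0) + finrank K (Y 1) + finrank K (Y 2) := by
    rw [hY2, finrank_eq_finrank_map_add_finrank_inf_ker W (ρ 2)]
    change finrank K (W.map (ρ 2)) + finrank K V₁ = _
    rw [hdimV₁]
    ring
  -- membership unpacking
  have memV₁ : ∀ x ∈ V₁, x ∈ W ∧ ∀ j, x (2, j) = 0 := fun x hx => by
    simp only [V₁, Submodule.mem_inf, LinearMap.mem_ker] at hx
    exact ⟨hx.1, fun j => congr_fun hx.2 j⟩
  have memV₀ : ∀ x ∈ V₀, x ∈ W ∧ (∀ j, x (1, j) = 0) ∧ ∀ j, x (2, j) = 0 := fun x hx => by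
    simp only [V₀, V₁, Submodule.mem_inf, LinearMap.mem_ker] at hx
    exact ⟨hx.1.1, fun j => congr_fun hx.2 j, fun j => congr_fun hx.1.2 j⟩
  have mkV₁ : ∀ x ∈ W, (∀ j, x (2, j) = 0) → x ∈ V₁ := fun x hx h2 => by
    simp only [V₁, Submodule.mem_inf, LinearMap.mem_ker]
    exact ⟨hx, funext fun j => h2 j⟩
  have mkV₀ : ∀ x ∈ W, (∀ j, x (1, j) = 0) → (∀ j, x (2, j) = 0) → x ∈ V₀ := fun x hx h1 h2 => by
    simp only [V₀, V₁, Submodule.mem_inf, LinearMap.mem_ker]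
    exact ⟨⟨hx, funext fun j => h2 j⟩, funext fun j => h1 j⟩
  -- an element of level `p` comes from `x ∈ W` with row `p` equal to it and the later rows zero
  have lift : ∀ p, ∀ u ∈ Y p, ∃ x ∈ W, (∀ j, x (p, j) = u j) ∧ ∀ q, p < q → ∀ j, x (q, j) = 0 := by
    intro p u hu
    have hcases : ∀ p : Fin 3, p = 0 ∨ p = 1 ∨ p = 2 := by decide
    rcases hcases p with rfl | rfl | rfl
    · rw [hY0, Submodule.mem_map] at hu
      obtain ⟨x, hx, rfl⟩ := hu
      obtain ⟨hxW, hx1, hx2⟩ := memV₀ x hx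
      refine ⟨x, hxW, fun j => rfl, fun q hq j => ?_⟩
      have hq' : q = 1 ∨ q = 2 := by revert q; decide
      rcases hq' with rfl | rfl
      · exact hx1 j
      · exact hx2 j
    · rw [hY1, Submodule.mem_map] at hu
      obtain ⟨x, hx, rfl⟩ := hu
      obtain ⟨hxW, hx2⟩ := memV₁ x hx
      refine ⟨x, hxW, fun j => rfl, fun q hq j => ?_⟩
      have hq' : q = 2 := by revert q; decide
      subst hq'
      exact hx2 j
    · rw [hY2, Submodule.mem_map] at hu
      obtain ⟨x, hx, rfl⟩ := hu
      exact ⟨x, hx, fun j => rfl, fun q hq j => absurd hq (by revert q; decide)⟩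
  -- the pairings between two different levels of the flag (polarisation of the quadrics)
  have hP : ∀ p q : Fin 3, q ≠ p → ∀ u ∈ Y p, ∀ v ∈ Y q,
      ∀ c₀ j : Fin 3, j ≠ c₀ → u c₀ * v j + u j * v c₀ = 0 := by
    intro p q hpq u hu v hv c₀ j hj
    obtain ⟨x, hx, hxu, hxz⟩ := lift p u hu
    obtain ⟨x', hx', hx'v, hx'z⟩ := lift q v hv
    rcases lt_or_gt_of_ne hpq with h | h
    · -- `q < p`: row `p` of `x'` vanishes
      have e := cross_pairing W hQ' (p := q) (q := p) hpq hx' hx (hx'z p h) c₀ j hj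
      rw [hx'v, hx'v, hxu, hxu] at e
      linear_combination e
    · -- `p < q`: row `q` of `x` vanishes
      have e := cross_pairing W hQ' (p := p) (q := q) (Ne.symm hpq) hx hx' (hxz q h) c₀ j hj
      rw [hxu, hxu, hx'v, hx'v] at e
      exact e
  -- the count: `dim W = n₀ + n₁ + n₂ = 3`, and `n_q ≥ 1 ⇒ n_p ≤ 1`
  have hle : ∀ i, finrank K (Y i) ≤ 3 := fun i =>
    ((Y i).finrank_le).trans (by rw [finrank_fintype_fun_eq_card, Fintype.card_fin])
  have hPL : ∀ p q, p ≠ q → 1 ≤ finrank K (Y q) → finrank K (Y p) ≤ 1 := by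
    intro p q hpq hq
    have hne : Y q ≠ ⊥ := fun h => by rw [h, finrank_bot] at hq; exact absurd hq (by decide)
    obtain ⟨v, hv, hv0⟩ := Submodule.exists_mem_ne_zero_of_ne_bot hne
    obtain ⟨c₀, hc₀⟩ : ∃ c₀, v c₀ ≠ 0 := by
      by_contra hall
      push Not at hall
      exact hv0 (funext hall)
    exact finrank_le_one_of_pairings (Y p) v hc₀ fun u hu => hP p q (Ne.symm hpq) u hu v hv c₀
  have hsum : finrank K (Y 0) + finrank K (Y 1) + finrank K (Y 2) = 3 := by
    have := sum_le_three_of_pairwise (fun i => finrank K (Y i)) hle hPL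
    omega
  -- case analysis on the profile
  by_cases h2pos : 1 ≤ finrank K (Y 2)
  · by_cases h1pos : 1 ≤ finrank K (Y 1)
    · -- profile (1,1,1): the COLUMN case
      right
      have n0 : finrank K (Y 0) = 1 := by
        have := hPL 0 1 (by decide) h1pos; have := hPL 1 2 (by decide) h2pos
        have := hPL 2 1 (by decide) h1pos; omega
      have n1 : finrank K (Y 1) = 1 := by
        have := hPL 1 2 (by decide) h2pos; omega
      have n2 : finrank K (Y 2) = 1 := by
        have := hPL 2 1 (by decide) h1pos; omega
      -- generators
      have gen : ∀ p, finrank K (Y p) = 1 → ∃ g ∈ Y p, g ≠ 0 ∧ ∀ y ∈ Y p, ∃ c : K, y = c • g := by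
        intro p hp
        have hne : Y p ≠ ⊥ := fun h => by rw [h, finrank_bot] at hp; exact absurd hp (by decide)
        obtain ⟨g, hg, hg0⟩ := Submodule.exists_mem_ne_zero_of_ne_bot hne
        refine ⟨g, hg, hg0, fun y hy => ?_⟩
        have hg0' : (⟨g, hg⟩ : Y p) ≠ 0 := fun h => hg0 (congr_arg Subtype.val h)
        obtain ⟨c, hc⟩ := (finrank_eq_one_iff_of_nonzero' (⟨g, hg⟩ : Y p) hg0').1 hp ⟨y, hy⟩
        exact ⟨c, (congr_arg Subtype.val hc).symm⟩
      obtain ⟨u, hu, hu0, hgu⟩ := gen 0 n0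
      obtain ⟨v, hv, hv0, hgv⟩ := gen 1 n1
      obtain ⟨w, hw, hw0, hgw⟩ := gen 2 n2
      obtain ⟨i, hi⟩ := exists_common_index_of_pairings h2 hu0 hv0 hw0
        (hP 0 1 (by decide) u hu v hv) (hP 0 2 (by decide) u hu w hw) (hP 1 2 (by decide) v hv w hw)
      -- every element of each level is supported at column `i`
      have lev : ∀ p, ∀ y ∈ Y p, ∀ j, j ≠ i → y j = 0 := by
        intro p y hy j hj
        have hcases : ∀ p : Fin 3, p = 0 ∨ p = 1 ∨ p = 2 := by decide
        rcases hcases p with rfl | rfl | rfl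
        · obtain ⟨c, rfl⟩ := hgu y hy
          rw [Pi.smul_apply, (hi j hj).1, smul_zero]
        · obtain ⟨c, rfl⟩ := hgv y hy
          rw [Pi.smul_apply, (hi j hj).2.1, smul_zero]
        · obtain ⟨c, rfl⟩ := hgw y hy
          rw [Pi.smul_apply, (hi j hj).2.2, smul_zero]
      refine ⟨i, fun x hx r j hj => ?_⟩
      -- row 2
      have hr2 : ∀ j, j ≠ i → x (2, j) = 0 := fun j hj => by
        have hm : ρ 2 x ∈ Y 2 := by rw [hY2]; exact Submodule.mem_map_of_mem hx
        have := lev 2 _ hm j hj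
        rwa [hρ] at this
      -- row 1
      have hr1 : ∀ j, j ≠ i → x (1, j) = 0 := fun j hj => by
        by_cases h2i : x (2, i) = 0
        · have hx1 : x ∈ V₁ := mkV₁ x hx fun j' => by
            by_cases h' : j' = i
            · rw [h']; exact h2i
            · exact hr2 j' h'
          have hm : ρ 1 x ∈ Y 1 := by rw [hY1]; exact Submodule.mem_map_of_mem hx1
          have := lev 1 _ hm j hj
          rwa [hρ] at this
        · have e := hQ' x hx 1 2 (by decide) j i (Ne.symm hj)
          rw [hr2 j hj, mul_zero, add_zero] at e
          exact (mul_eq_zero.1 e).resolve_right h2i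
      have hcases : ∀ r : Fin 3, r = 0 ∨ r = 1 ∨ r = 2 := by decide
      rcases hcases r with rfl | rfl | rfl
      · -- row 0
        by_cases h2i : x (2, i) = 0
        · have h2all : ∀ j', x (2, j') = 0 := fun j' => by
            by_cases h' : j' = i
            · rw [h']; exact h2i
            · exact hr2 j' h'
          have hx1 : x ∈ V₁ := mkV₁ x hx h2all
          by_cases h1i : x (1, i) = 0
          · have h1all : ∀ j', x (1, j') = 0 := fun j' => by
              by_cases h' : j' = i
              · rw [h']; exact h1i
              · exact hr1 j' h'
            have hx0 : x ∈ V₀ := mkV₀ x hx h1all h2all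
            have hm : ρ 0 x ∈ Y 0 := by rw [hY0]; exact Submodule.mem_map_of_mem hx0
            have := lev 0 _ hm j hj
            rwa [hρ] at this
          · have e := hQ' x hx 0 1 (by decide) j i (Ne.symm hj)
            rw [hr1 j hj, mul_zero, add_zero] at e
            exact (mul_eq_zero.1 e).resolve_right h1i
        · have e := hQ' x hx 0 2 (by decide) j i (Ne.symm hj)
          rw [hr2 j hj, mul_zero, add_zero] at e
          exact (mul_eq_zero.1 e).resolve_right h2i
      · exact hr1 j hj
      · exact hr2 j hj
    · -- profile (0,0,3): ROW 2
      left
      have n1 : finrank K (Y 1) = 0 := by omega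
      have n0 : finrank K (Y 0) = 0 := by
        have := hPL 0 2 (by decide) h2pos
        by_contra h0
        have h0' : 1 ≤ finrank K (Y 0) := by omega
        have := hPL 2 0 (by decide) h0'
        omega
      have n2 : finrank K (W.map (LinearMap.funLeft K K fun j : Fin 3 => ((2 : Fin 3), j))) = 3 := by
        change finrank K (Y 2) = 3
        omega
      refine ⟨2, ?_⟩
      obtain ⟨x0, hx0, e0⟩ := exists_preimage_single W 2 n2 0
      obtain ⟨x1, hx1, e1⟩ := exists_preimage_single W 2 n2 1
      obtain ⟨x2, hx2, e2⟩ := exists_preimage_single W 2 n2 2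
      let xs : Fin 3 → (Fin 3 × Fin 3 → K) := ![x0, x1, x2]
      have hxs : ∀ a, xs a ∈ W := by
        intro a; fin_cases a <;> assumption
      have hq : ∀ a j, xs a (2, j) = if j = a then 1 else 0 := by
        intro a j; fin_cases a
        · exact e0 j
        · exact e1 j
        · exact e2 j
      have k0 := rows_vanish_of_full_row h2 W hQ' 0 2 (by decide) xs hxs hq
      have k1 := rows_vanish_of_full_row h2 W hQ' 1 2 (by decide) xs hxs hq
      have hker : (W ⊓ LinearMap.ker (ρ 2) : Submodule K _) = ⊥ := by
        apply Submodule.finrank_eq_zero.1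
        change finrank K V₁ = 0
        rw [hdimV₁, n1, n0]
      intro x hx i j hi
      rw [eq_sum_of_full_row W 2 xs hxs hq hker x hx, Finset.sum_apply]
      simp only [Pi.smul_apply, smul_eq_mul]
      have hcases : i = 0 ∨ i = 1 := by
        have : ∀ i : Fin 3, i ≠ 2 → i = 0 ∨ i = 1 := by decide
        exact this i hi
      refine Finset.sum_eq_zero fun a _ => ?_
      rcases hcases with rfl | rfl
      · rw [k0 a j, mul_zero]
      · rw [k1 a j, mul_zero]
  · -- `Y 2 = ⊥`: row 2 vanishes on `W`, so `V₁ = W`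
    have n2 : finrank K (Y 2) = 0 := by omega
    have hrow2 : ∀ x ∈ W, ∀ j, x (2, j) = 0 := by
      intro x hx j
      have hb : Y 2 = ⊥ := Submodule.finrank_eq_zero.1 n2
      have hm : ρ 2 x ∈ Y 2 := by rw [hY2]; exact Submodule.mem_map_of_mem hx
      rw [hb, Submodule.mem_bot] at hm
      have := congr_fun hm j
      rwa [hρ] at this
    have hWV₁ : ∀ x ∈ W, x ∈ V₁ := fun x hx => mkV₁ x hx (hrow2 x hx)
    by_cases h1pos : 1 ≤ finrank K (Y 1)
    · -- profile (0,3,0): ROW 1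
      left
      have n0 : finrank K (Y 0) = 0 := by
        have := hPL 0 1 (by decide) h1pos
        by_contra h0
        have h0' : 1 ≤ finrank K (Y 0) := by omega
        have := hPL 1 0 (by decide) h0'
        omega
      have n1 : finrank K (V₁.map (LinearMap.funLeft K K fun j : Fin 3 => ((1 : Fin 3), j))) = 3 := by
        change finrank K (Y 1) = 3
        omega
      refine ⟨1, ?_⟩
      obtain ⟨x0, hx0, e0⟩ := exists_preimage_single V₁ 1 n1 0
      obtain ⟨x1, hx1, e1⟩ := exists_preimage_single V₁ 1 n1 1
      obtain ⟨x2, hx2, e2⟩ := exists_preimage_single V₁ 1 n1 2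
      let xs : Fin 3 → (Fin 3 × Fin 3 → K) := ![x0, x1, x2]
      have hxsV : ∀ a, xs a ∈ V₁ := by
        intro a; fin_cases a <;> assumption
      have hxs : ∀ a, xs a ∈ W := fun a => (memV₁ _ (hxsV a)).1
      have hq : ∀ a j, xs a (1, j) = if j = a then 1 else 0 := by
        intro a j; fin_cases a
        · exact e0 j
        · exact e1 j
        · exact e2 j
      have k0 := rows_vanish_of_full_row h2 W hQ' 0 1 (by decide) xs hxs hq
      have hker : (V₁ ⊓ LinearMap.ker (ρ 1) : Submodule K _) = ⊥ := by
        apply Submodule.finrank_eq_zero.1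
        change finrank K V₀ = 0
        rw [hdimV₀, n0]
      intro x hx i j hi
      have hcases : i = 0 ∨ i = 2 := by
        have : ∀ i : Fin 3, i ≠ 1 → i = 0 ∨ i = 2 := by decide
        exact this i hi
      rcases hcases with rfl | rfl
      · rw [eq_sum_of_full_row V₁ 1 xs hxsV hq hker x (hWV₁ x hx), Finset.sum_apply]
        simp only [Pi.smul_apply, smul_eq_mul]
        exact Finset.sum_eq_zero fun a _ => by rw [k0 a j, mul_zero]
      · exact hrow2 x hx j
    · -- profile (3,0,0): ROW 0 (rows 1 and 2 vanish)
      left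
      have n1 : finrank K (Y 1) = 0 := by omega
      refine ⟨0, fun x hx i j hi => ?_⟩
      have hcases : i = 1 ∨ i = 2 := by
        have : ∀ i : Fin 3, i ≠ 0 → i = 1 ∨ i = 2 := by decide
        exact this i hi
      rcases hcases with rfl | rfl
      · have hb : Y 1 = ⊥ := Submodule.finrank_eq_zero.1 n1
        have hm : ρ 1 x ∈ Y 1 := by rw [hY1]; exact Submodule.mem_map_of_mem (hWV₁ x hx)
        rw [hb, Submodule.mem_bot] at hm
        have := congr_fun hm j
        rwa [hρ] at this
      · exact hrow2 x hx j

end AlperBogartVelasco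

end Literature.Computability.AlgebraicComplexity
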